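import Literature.Barriers.CriticalPhenomena.LaceExpansionHighDimensionProofs
import Literature.Probability.Percolation.MeanFieldBetaFromGamma
import HarnessLib

/-!
# Kozma–Nachmias 2011, the upper bound `P_{p_c}(0 ↔ ∂Q_r) ≤ C r⁻²`: decomposition of the
# named fact `KozmaNachmias2011_oneArmUpper`, and the induction of §2 PROVED

Barrier catalogue `Literature/Barriers/CriticalPhenomena/` (D-0021), companion of
`LaceExpansionHighDimension.lean` / `LaceExpansionHighDimensionProofs.lean`. The latter vendors the
upper half of Kozma–Nachmias's Thm. 1 (conditional version, §1.1: `d > 6` and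
`τ_{p_c}(0,x) ≈ |x|^{2-d}` imply `P_{p_c}(0 ↔ ∂Q_r) ≤ C r^{-2}`) as the named fact
`KozmaNachmias2011_oneArmUpper`. The printed proof (Kozma–Nachmias 2011, §2 "The induction
scheme: Proof of Theorem 1 using Theorem 2", pp. 382–384) has three layers, which this file
separates into named facts so that they can be discharged bottom-up:

1. **(1.1), upper half** — `P_{p_c}(|C(0)| > n) ≤ C n^{-1/2}` (Barsky–Aizenman 1991; "in [6] it is
   shown that this estimate [(1.2)] implies (1.1)", p. 377): `KozmaNachmias2011_volumeTail`.
2. **Theorem 2** (p. 378, the "hardest part", Chapters 3–5 of the paper: the connection lower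
   bound Lemma 1.1, the regularity Thms. 4–5, and the second-moment argument of Chapter 5):
   `KozmaNachmias2011_thm2`, stated with the random variables `X_j` (1.3) and `A_j` (1.4),
   here `boundaryConnCount` and `annulusConnCount`.
3. **Lemma 2.3** (p. 382), the recursive inequality
   `γ(r(1+λ)) ≤ C₁ ε^{-1/2} r^{-2} + ε^{3/5} r² γ(r) γ(λr/2) + (1 - c₁) γ(r)` for
   `γ(r) = P(0 ↔ ∂Q_r)`: `KozmaNachmias2011_lemma23`, via the predicate `OneArmRecursion γ`.
   All exponents of `ε` in the source (`1/2, 3/5, 3/10, 1/5, 1/10`) are multiples of `1/10`, so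
   we write `ε = η^{10}` and only natural powers of `η` occur (`ε^{-1/2} = η^{-5}`,
   `ε^{3/5} = η^6`); and, as in the source (p. 380, "we will not be very strict about `r` being an
   integer … `Q_r = Q_{⌊r⌋}`"), `γ` of a real argument `s ≥ 0` means `γ(⌊s⌋)`.

PROVED here:

* `upper_of_oneArmRecursion` — **the induction of p. 384** ("Proof of Theorem 1"): a function
  `γ : ℕ → [0, 1]` satisfying the recursion (2.1) obeys `γ(n) ≤ M/n²` for all `n ≥ 1`. The
  printed choice is `(1+λ)² ≤ 2`, `(1-c₁)(1+λ)² ≤ 1 - c₁/2`, `(2C₁ + 8λ^{-2}) M^{-1/11} ≤ c₁/2`,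
  `M^{-20/11} ≤ ε₀(λ)`, `ε = M^{-20/11}`; we take `M = m^{11}`, `η = m^{-2}` and absorb the
  rounding `γ(r) = γ(⌊r⌋) ≤ M/⌊r⌋² ≤ M/((1 - 1/r₀)r)²` (which the source leaves implicit) into the
  choice of `λ = c₁/8` and of the base range `n ≤ n₀`.
* `KozmaNachmias2011_oneArmUpper_of_lemma23 : KozmaNachmias2011_lemma23 →
  KozmaNachmias2011_oneArmUpper`.

So after this file the trust base of `KozmaNachmias2011_oneArmUpper` is `KozmaNachmias2011_lemma23`,
which the paper proves from `KozmaNachmias2011_volumeTail` and `KozmaNachmias2011_thm2`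
(pp. 382–384; to be formalised in a sibling file), and (1.1) in turn follows from the triangle
condition (Barsky–Aizenman 1991; or Aizenman–Newman's `γ = 1` with Hutchcroft 2022, Thm. 1.3,
`Literature.Probability.Percolation.Hutchcroft2022_thm13_holds`).

## References

* G. Kozma, A. Nachmias, *Arm exponents in high dimensional percolation*, J. Amer. Math. Soc. 24
  (2011) 375–409: (1.1) p. 376; Thm. 1 (conditional version) and (1.2) p. 377; (1.3)–(1.4) and
  Thm. 2 p. 378; §1.6 (notation `Q_r`, `∂Q_r`, `x ↔ y` in `A`, `C(x; A)`) p. 380; Lemma 2.3 and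
  its proof pp. 382–384; "Proof of Theorem 1" p. 384.
* D. J. Barsky, M. Aizenman, *Percolation critical exponents under the triangle condition*,
  Ann. Probab. 19 (1991) 1520–1536 (`δ = 2`).
* M. Heydenreich, R. van der Hofstad, *Progress in High-Dimensional Percolation and Random
  Graphs*, Springer 2017, Thm. 11.5 (11.3.2) and §11.3.2 (sketch of the Kozma–Nachmias argument).
-/

noncomputable section

namespace Literature.Barriers.CriticalPhenomena

open _root_.MeasureTheory _root_.Filter Finset Literature.Probability.LatticeModels
  Literature.Probability.Percolation
open scoped Literature.Probability.LatticeModels Literature.Probability.Percolation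

variable {d : ℕ}

/-! ### The random variables `X_j` (1.3) and `A_j` (1.4) -/

section RandomVariables

open scoped Classical in
/-- **`X_j`** (Kozma–Nachmias 2011, (1.3)): the number of vertices `x` of the boundary `∂Q_j` of
the cube `Q_j = {-j,…,j}^d` that are joined to the origin by an open path lying in `Q_j`
(`0 ↔ x` in `Q_j`, §1.6). On the nearest-neighbour lattice `∂Q_j` (the vertices of `Q_j` with a
neighbour outside, §1.6) is the sup-norm sphere `sphere d j`
(`Literature.Probability.LatticeModels.innerBoundary_box`). [cite: KozmaNachmias2011, (1.3) and §1.6] -/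
def boundaryConnCount (d j : ℕ) (ω : BondConfig (Site d)) : ℕ :=
  #((sphere d j).filter fun x => ω ∈ openConnIn (↑(box d j) : Set (Site d)) (0 : Site d) x)

open scoped Classical in
/-- **`A_j`** (Kozma–Nachmias 2011, (1.4)), with its width parameter `L` explicit: the number of
vertices `y ∈ Q_{j+L} ∖ Q_j` joined to the origin by an open path (anywhere in `ℤ^d`).
[cite: KozmaNachmias2011, (1.4)] -/
def annulusConnCount (d j L : ℕ) (ω : BondConfig (Site d)) : ℕ :=
  #((box d (j + L) \ box d j).filter fun y => ω ∈ openConn (0 : Site d) y)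

/-- `X_j ≤ |∂Q_j|`. [folklore] -/
theorem boundaryConnCount_le_card_sphere (j : ℕ) (ω : BondConfig (Site d)) :
    boundaryConnCount d j ω ≤ #(sphere d j) := by
  classical
  unfold boundaryConnCount
  convert Finset.card_filter_le (sphere d j) _

/-- `A_j ≤ |Q_{j+L} ∖ Q_j|`. [folklore] -/
theorem annulusConnCount_le_card (j L : ℕ) (ω : BondConfig (Site d)) :
    annulusConnCount d j L ω ≤ #(box d (j + L) \ box d j) := by
  classical
  unfold annulusConnCount
  convert Finset.card_filter_le (box d (j + L) \ box d j) _

end RandomVariables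

/-! ### The three printed inputs of the upper bound, as named facts -/

section Facts

/-- NAMED FACT — **(1.1), upper half, in the conditional setting of Thm. 1** (Kozma–Nachmias 2011,
p. 376: "in high dimensions we have (1.1) `P_{p_c}(|C(0)| > n) ≈ 1/√n`", due to Barsky–Aizenman
[6] and Hara–Slade [19]; p. 377: "in [6] it is shown that this estimate [(1.2),
`P_{p_c}(0 ↔ x) ≈ |x|^{2-d}`] implies (1.1)"). Vendored as what §2 uses (terms `B₁`, Lemma 4.3):
on `ℤ^d` with `d > 6` and the two-point estimate in the bounded-ratio form
`TwoPointBoundedRatio d`, there is `C` with `P_{p_c}(|C(0)| ≥ n) ≤ C/√n` for all `n ≥ 1`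
(`{|C(0)| ≥ n}` is `clusterSizeGe 0 n`). Barsky–Aizenman prove `δ = 2` in the bounded-ratio
sense (`P_{p_c}(|C(0)| ≥ n) ≍ n^{-1/δ}`, Heydenreich–van der Hofstad 2017, (1.2.10) and Thm. 4.1)
under the triangle condition, which (1.2) implies for `d > 6`.
Users take `(h : KozmaNachmias2011_volumeTail)`.
[cite: KozmaNachmias2011, (1.1) and §1.1 (p. 377)]
[cite: HeydenreichVanDerHofstad2017, Thm. 4.1 with (1.2.10)] -/
def KozmaNachmias2011_volumeTail : Prop :=
  ∀ d : ℕ, 6 < d → TwoPointBoundedRatio d → ∃ C : ℝ, ∀ n : ℕ, 1 ≤ n →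
    (bondPercolation (zdGraph d) (criticalProbI d)).real (clusterSizeGe (0 : Site d) n) ≤ C / Real.sqrt n

/-- NAMED FACT — **Kozma–Nachmias 2011, Theorem 2** (p. 378): "There exists a constant `c > 0`
such that for any `j` sufficiently large, and any `L ≥ j^{1/10}` we have
`P_{p_c}(X_j ≥ L² and A_j ≤ cL⁴) ≤ (1 - c) P_{p_c}(0 ↔ ∂Q_j)`", where `X_j` is (1.3)
(`boundaryConnCount d j`), `A_j = |{y ∈ Q_{j+L} ∖ Q_j : 0 ↔ y}|` is (1.4) (`annulusConnCount d j L`)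
for "an integer `L ∈ [0, r]`", `j ∈ [r, 2r]` (so `L ≤ j`), and `P(0 ↔ ∂Q_j)` is
`oneArmProb d p_c j`. Vendored for the nearest-neighbour lattice `ℤ^d` under the hypotheses
(i) `d > 6` and (ii) the two-point estimate (`TwoPointBoundedRatio d`) of the conditional Thm. 1
(§1.1; (iii), symmetry of the edge set, holds for `ℤ^d`), under which the paper's proof
(Chapters 3–5: Lemma 1.1, the regularity Thms. 4–5, Lemmas 5.1–5.5) operates. Not proved here.
Users take `(h : KozmaNachmias2011_thm2)`.
[cite: KozmaNachmias2011, Thm. 2 (p. 378) with (1.3)–(1.4)] -/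
def KozmaNachmias2011_thm2 : Prop :=
  ∀ d : ℕ, 6 < d → TwoPointBoundedRatio d →
    ∃ c : ℝ, 0 < c ∧ ∃ j₀ : ℕ, ∀ j : ℕ, j₀ ≤ j → ∀ L : ℕ, (j : ℝ) ^ ((1 : ℝ) / 10) ≤ L → L ≤ j →
      (bondPercolation (zdGraph d) (criticalProbI d)).real
          {ω | (L : ℝ) ^ 2 ≤ boundaryConnCount d j ω ∧
            (annulusConnCount d j L ω : ℝ) ≤ c * (L : ℝ) ^ 4} ≤
        (1 - c) * oneArmProb d (criticalProbI d) j

/-- **The recursive inequality (2.1) of Kozma–Nachmias 2011, Lemma 2.3**, as a property of a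
function `γ : ℕ → ℝ` (to be read `γ(s) := γ(⌊s⌋)` at real `s ≥ 0`, as `Q_s = Q_{⌊s⌋}`, p. 380):
"There exist positive constants `c₁` and `C₁` such that for all `λ ∈ (0, 1]` there exists
`ε₀ = ε₀(λ)` such that for all `ε ∈ (0, ε₀)` we have
`γ(r(1+λ)) ≤ C₁/(√ε r²) + ε^{3/5} r² γ(r) γ(λr/2) + (1 - c₁) γ(r)`" (for all `r > 0`; for small
`r` the first term exceeds `1`, p. 383). We substitute `ε = η^{10}` (`η ∈ (0, η₀)`,
`η₀ = ε₀^{1/10}`), under which `1/√ε = η^{-5}` and `ε^{3/5} = η^6`, so that only natural powers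
appear; this is a bijective reparametrisation of `(0, ε₀)`. [cite: KozmaNachmias2011, Lemma 2.3 (2.1)] -/
def OneArmRecursion (γ : ℕ → ℝ) : Prop :=
  ∃ c₁ C₁ : ℝ, 0 < c₁ ∧ 0 < C₁ ∧ ∀ lam : ℝ, 0 < lam → lam ≤ 1 → ∃ η₀ : ℝ, 0 < η₀ ∧
    ∀ η : ℝ, 0 < η → η < η₀ → ∀ r : ℝ, 0 < r →
      γ ⌊r * (1 + lam)⌋₊ ≤ C₁ / (η ^ 5 * r ^ 2) +
        η ^ 6 * r ^ 2 * γ ⌊r⌋₊ * γ ⌊lam * r / 2⌋₊ + (1 - c₁) * γ ⌊r⌋₊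

/-- NAMED FACT — **Kozma–Nachmias 2011, Lemma 2.3** (p. 382) for `γ(r) = P_{p_c}(0 ↔ ∂Q_r)` on
`ℤ^d`, under the hypotheses (i) `d > 6`, (ii) `TwoPointBoundedRatio d` of the conditional Thm. 1:
`γ` satisfies the recursion (2.1) (`OneArmRecursion`, with `ε = η^{10}`). The source derives it
from (1.1) (`KozmaNachmias2011_volumeTail`) and Thm. 2 (`KozmaNachmias2011_thm2`) on pp. 382–384
(terms `B₁, B₂, B₃`). Users take `(h : KozmaNachmias2011_lemma23)`.
[cite: KozmaNachmias2011, Lemma 2.3] -/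
def KozmaNachmias2011_lemma23 : Prop :=
  ∀ d : ℕ, 6 < d → TwoPointBoundedRatio d → OneArmRecursion (oneArmProb d (criticalProbI d))

end Facts

/-! ### The induction of §2 ("Proof of Theorem 1", p. 384), PROVED -/

section Induction

/-- Rounding: if `1 ≤ k`, `a ≤ k` with `0 < a`, and `γ k ≤ M/k²` with `0 ≤ M`, then
`γ k ≤ M/a²`. [folklore] -/
theorem le_div_sq_of_le_div_natCast_sq {γ : ℕ → ℝ} {M a : ℝ} {k : ℕ} (hM : 0 ≤ M) (ha : 0 < a)
    (hak : a ≤ k) (h : γ k ≤ M / (k : ℝ) ^ 2) : γ k ≤ M / a ^ 2 :=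
  h.trans (div_le_div_of_nonneg_left hM (by positivity) (by gcongr))

/-- **The constants of the induction** (p. 384: "fix `λ > 0` sufficiently small that
`(1+λ)² ≤ 2`, `(1-c₁)(1+λ)² ≤ 1 - c₁/2`"), together with the rounding factor `ρ = 1 - 1/r₀`
absorbing `γ(⌊r⌋) ≤ M/⌊r⌋² ≤ M/(ρr)²` for `r ≥ r₀`: for `c ∈ (0, 1/2]` there are `λ ∈ (0, 1]`,
`r₀ ≥ 4/λ` and `ρ = 1 - 1/r₀` with `(1+λ)² ≤ 2`, `ρ² ≥ 1/2` and `(1-c)(1+λ)²/ρ² ≤ 1 - c/2`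
(take `λ = c/8`, `r₀ = 4/λ + 8/c`). [cite: KozmaNachmias2011, §2, Proof of Theorem 1 (2.3)] -/
theorem oneArmRecursion_constants {c : ℝ} (hc0 : 0 < c) (hc2 : c ≤ 1 / 2) :
    ∃ lam r₀ ρ : ℝ, 0 < lam ∧ lam ≤ 1 ∧ (1 + lam) ^ 2 ≤ 2 ∧ 0 < r₀ ∧ 4 / lam ≤ r₀ ∧
      ρ = 1 - 1 / r₀ ∧ 0 < ρ ∧ 1 / 2 ≤ ρ ^ 2 ∧ (1 - c) * (1 + lam) ^ 2 / ρ ^ 2 ≤ 1 - c / 2 := by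
  -- `λ = c/8`: `(1+λ)² ≤ 2` and `(1-c)(1+λ)² ≤ 1 - 3c/4`
  obtain ⟨lam, hlam0, hlam1, hlam_sq, hlam_c⟩ : ∃ lam : ℝ, 0 < lam ∧ lam ≤ 1 ∧ (1 + lam) ^ 2 ≤ 2 ∧
      (1 - c) * (1 + lam) ^ 2 ≤ 1 - 3 * c / 4 := by
    refine ⟨c / 8, by positivity, by linarith, by nlinarith, ?_⟩
    have : (1 - c) * (1 + c / 8) ^ 2 = 1 - 3 * c / 4 - (15 * c ^ 2 / 64 + c ^ 3 / 64) := by ring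
    rw [this]
    linarith [show 0 ≤ 15 * c ^ 2 / 64 + c ^ 3 / 64 by positivity]
  -- `r₀ = 4/λ + 8/c`, `ρ = 1 - 1/r₀ ≥ 1 - c/8`
  obtain ⟨r₀, hr₀0, hr₀lam, hr₀c⟩ : ∃ r₀ : ℝ, 0 < r₀ ∧ 4 / lam ≤ r₀ ∧ 8 / c ≤ r₀ :=
    ⟨4 / lam + 8 / c, by positivity, by linarith [div_pos (by norm_num : (0:ℝ) < 8) hc0],
      by linarith [div_pos (by norm_num : (0:ℝ) < 4) hlam0]⟩
  refine ⟨lam, r₀, 1 - 1 / r₀, hlam0, hlam1, hlam_sq, hr₀0, hr₀lam, rfl, ?_⟩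
  have hρc : 1 - c / 8 ≤ 1 - 1 / r₀ := by
    have : 1 / r₀ ≤ c / 8 :=
      calc 1 / r₀ ≤ 1 / (8 / c) := one_div_le_one_div_of_le (by positivity) hr₀c
        _ = c / 8 := one_div_div 8 c
    linarith
  have hρ0 : 0 < 1 - 1 / r₀ := by linarith
  have hρsq : 1 - c / 4 ≤ (1 - 1 / r₀) ^ 2 := by
    have h' : (1 - c / 8) ^ 2 ≤ (1 - 1 / r₀) ^ 2 := pow_le_pow_left₀ (by linarith) hρc 2
    have h'' : (1 - c / 8) ^ 2 = 1 - c / 4 + c ^ 2 / 64 := by ring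
    linarith [sq_nonneg c]
  refine ⟨hρ0, by linarith, ?_⟩
  rw [div_le_iff₀ (by positivity)]
  have : (1 - c / 2) * (1 - c / 4) = 1 - 3 * c / 4 + c ^ 2 / 8 := by ring
  calc (1 - c) * (1 + lam) ^ 2 ≤ 1 - 3 * c / 4 := hlam_c
    _ ≤ (1 - c / 2) * (1 - c / 4) := by rw [this]; linarith [sq_nonneg c]
    _ ≤ (1 - c / 2) * (1 - 1 / r₀) ^ 2 := mul_le_mul_of_nonneg_left hρsq (by linarith)

/-- **The arithmetic of the induction step** (p. 384, the display after "We now use Lemma 2.3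
with `ε = M^{-20/11}`"): with `M = m^{11}`, `η = m^{-2}` (so `η^{-5} = M/m`, `η^6 M² = M/m`),
the recursion (2.1) at `r` and the rounded induction hypotheses `γ(⌊r⌋) ≤ M/(ρr)²`,
`γ(⌊λr/2⌋) ≤ M/(λr/4)²` give `γ(r(1+λ)) ≤ (M/r²)·[(C₁ + 32λ⁻²)/m + (1-c)/ρ²] ≤ M/(r(1+λ))²`
once `m ≥ 4(C₁ + 32λ⁻²)/c`. [cite: KozmaNachmias2011, §2, Proof of Theorem 1 (2.4)] -/
theorem oneArmRecursion_step {c c₁ C₁ lam ρ m M r g g₁ g₂ η : ℝ}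
    (hc0 : 0 < c) (hc2 : c ≤ 1 / 2) (hcc₁ : c ≤ c₁) (hC₁ : 0 < C₁) (hlam0 : 0 < lam)
    (hlam_sq : (1 + lam) ^ 2 ≤ 2) (hρ0 : 0 < ρ) (hρhalf : 1 / 2 ≤ ρ ^ 2)
    (hstep3 : (1 - c) * (1 + lam) ^ 2 / ρ ^ 2 ≤ 1 - c / 2) (hm0 : 0 < m) (hmA : 4 * (C₁ + 32 / lam ^ 2) / c ≤ m) (hM : M = m ^ 11) (hη : η = 1 / m ^ 2)
    (hr0 : 0 < r) (hg₁0 : 0 ≤ g₁) (hg₂0 : 0 ≤ g₂)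
    (hγ₁ : g₁ ≤ M / (ρ * r) ^ 2) (hγ₂ : g₂ ≤ M / (lam * r / 4) ^ 2)
    (hR : g ≤ C₁ / (η ^ 5 * r ^ 2) + η ^ 6 * r ^ 2 * g₁ * g₂ + (1 - c₁) * g₁) :
    g ≤ M / (r * (1 + lam)) ^ 2 := by
  have hM0 : 0 < M := by rw [hM]; positivity
  have hη0 : 0 < η := by rw [hη]; positivity
  have hη5 : 1 / η ^ 5 = M / m := by rw [hη, hM]; field_simp
  have hη6 : η ^ 6 * M * M = M / m := by rw [hη, hM]; field_simp
  -- the three terms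
  have hT1 : C₁ / (η ^ 5 * r ^ 2) = M / r ^ 2 * (C₁ / m) := by
    have : C₁ / (η ^ 5 * r ^ 2) = C₁ * (1 / η ^ 5) / r ^ 2 := by field_simp
    rw [this, hη5]
    field_simp
  have hT2 : η ^ 6 * r ^ 2 * g₁ * g₂ ≤ M / r ^ 2 * (32 / lam ^ 2 / m) := by
    have h16 : 16 / (ρ ^ 2 * lam ^ 2) ≤ 32 / lam ^ 2 := by
      rw [div_le_div_iff₀ (by positivity) (by positivity)]
      nlinarith [sq_nonneg lam, hρhalf]
    calc η ^ 6 * r ^ 2 * g₁ * g₂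
        ≤ η ^ 6 * r ^ 2 * (M / (ρ * r) ^ 2) * (M / (lam * r / 4) ^ 2) :=
          mul_le_mul (mul_le_mul_of_nonneg_left hγ₁ (by positivity)) hγ₂ hg₂0 (by positivity)
      _ = (η ^ 6 * M * M) / r ^ 2 * (16 / (ρ ^ 2 * lam ^ 2)) := by
          field_simp
          ring
      _ = M / r ^ 2 * (16 / (ρ ^ 2 * lam ^ 2) / m) := by rw [hη6]; ring
      _ ≤ M / r ^ 2 * (32 / lam ^ 2 / m) :=
          mul_le_mul_of_nonneg_left (div_le_div_of_nonneg_right h16 hm0.le) (by positivity)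
  have hT3 : (1 - c₁) * g₁ ≤ M / r ^ 2 * ((1 - c) / ρ ^ 2) := by
    calc (1 - c₁) * g₁ ≤ (1 - c) * g₁ := mul_le_mul_of_nonneg_right (by linarith) hg₁0
      _ ≤ (1 - c) * (M / (ρ * r) ^ 2) := mul_le_mul_of_nonneg_left hγ₁ (by linarith)
      _ = M / r ^ 2 * ((1 - c) / ρ ^ 2) := by field_simp
  -- sum up
  have hAm : (1 + lam) ^ 2 * ((C₁ + 32 / lam ^ 2) / m) ≤ c / 2 := by
    have h1 : (C₁ + 32 / lam ^ 2) / m ≤ c / 4 := by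
      rw [div_le_iff₀ hm0]
      have : 4 * (C₁ + 32 / lam ^ 2) ≤ m * c := by rwa [div_le_iff₀ hc0] at hmA
      linarith
    calc (1 + lam) ^ 2 * ((C₁ + 32 / lam ^ 2) / m) ≤ 2 * (c / 4) :=
          mul_le_mul hlam_sq h1 (by positivity) (by norm_num)
      _ = c / 2 := by ring
  have hbr : (1 + lam) ^ 2 * ((C₁ + 32 / lam ^ 2) / m + (1 - c) / ρ ^ 2) ≤ 1 := by
    have : (1 + lam) ^ 2 * ((1 - c) / ρ ^ 2) = (1 - c) * (1 + lam) ^ 2 / ρ ^ 2 := by ring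
    rw [mul_add, this]
    linarith
  calc g ≤ C₁ / (η ^ 5 * r ^ 2) + η ^ 6 * r ^ 2 * g₁ * g₂ + (1 - c₁) * g₁ := hR
    _ ≤ M / r ^ 2 * (C₁ / m) + M / r ^ 2 * (32 / lam ^ 2 / m) + M / r ^ 2 * ((1 - c) / ρ ^ 2) := by
        rw [hT1]; exact add_le_add (add_le_add le_rfl hT2) hT3
    _ = M / (r * (1 + lam)) ^ 2 * ((1 + lam) ^ 2 * ((C₁ + 32 / lam ^ 2) / m + (1 - c) / ρ ^ 2)) := by
        field_simp
    _ ≤ M / (r * (1 + lam)) ^ 2 * 1 := mul_le_mul_of_nonneg_left hbr (by positivity)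
    _ = M / (r * (1 + lam)) ^ 2 := mul_one _

/-- **Kozma–Nachmias 2011, "Proof of Theorem 1" (p. 384), PROVED in the abstract**: a function
`γ : ℕ → [0, 1]` satisfying the recursive inequality (2.1) of Lemma 2.3 (`OneArmRecursion γ`)
satisfies `γ(n) ≤ M/n²` for all `n ≥ 1`, for some constant `M`. Printed proof: fix `λ` with
`(1+λ)² ≤ 2`, `(1-c₁)(1+λ)² ≤ 1 - c₁/2`, then `M` with `(2C₁ + 8λ⁻²)M^{-1/11} ≤ c₁/2` and
`M^{-20/11} ≤ ε₀(λ)`, and prove `γ(s) ≤ M s⁻²` by induction using (2.1) with `ε = M^{-20/11}`.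
Here `λ = c/8` (`c = min(c₁, 1/2)`), `M = m^{11}`, `η = ε^{1/10} = m^{-2}`, the induction is on
`n = r(1+λ) ∈ ℕ`, and the rounding `γ(r) = γ(⌊r⌋) ≤ M/⌊r⌋²` is absorbed by a base range `n ≤ n₀`
(`oneArmRecursion_constants`, `oneArmRecursion_step`).
[cite: KozmaNachmias2011, §2, Proof of Theorem 1 (p. 384)] -/
theorem upper_of_oneArmRecursion {γ : ℕ → ℝ} (h0 : ∀ n, 0 ≤ γ n) (h1 : ∀ n, γ n ≤ 1)
    (hrec : OneArmRecursion γ) : ∃ M : ℝ, ∀ n : ℕ, 1 ≤ n → γ n ≤ M / (n : ℝ) ^ 2 := by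
  obtain ⟨c₁, C₁, hc₁, hC₁, H⟩ := hrec
  -- (0) replace `c₁` by `c = min c₁ (1/2) ∈ (0, 1/2]`
  obtain ⟨c, hc0, hc2, hcc₁⟩ : ∃ c : ℝ, 0 < c ∧ c ≤ 1 / 2 ∧ c ≤ c₁ :=
    ⟨min c₁ (1 / 2), lt_min hc₁ (by norm_num), min_le_right _ _, min_le_left _ _⟩
  -- (1)-(2) the constants `λ`, `r₀`, `ρ`
  obtain ⟨lam, r₀, ρ, hlam0, hlam1, hlam_sq, hr₀0, hr₀lam, hρ_def, hρ0, hρhalf, hstep3⟩ :=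
    oneArmRecursion_constants hc0 hc2
  obtain ⟨η₀, hη₀, Hη⟩ := H lam hlam0 hlam1
  have hlam4 : 4 ≤ 4 / lam := by rw [le_div_iff₀ hlam0]; nlinarith
  have hr₀4 : 4 ≤ r₀ := hlam4.trans hr₀lam
  obtain ⟨n₀, hn₀⟩ : ∃ n₀ : ℕ, r₀ * (1 + lam) ≤ n₀ := ⟨_, Nat.le_ceil _⟩
  -- (3) the choice of `M = m^{11}`, `η = m^{-2}`
  obtain ⟨m, hmA, hmη, hmn₀⟩ : ∃ m : ℝ, 4 * (C₁ + 32 / lam ^ 2) / c ≤ m ∧ 1 / η₀ + 1 ≤ m ∧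
      (n₀ : ℝ) ^ 2 + 1 ≤ m :=
    ⟨max (max (4 * (C₁ + 32 / lam ^ 2) / c) (1 / η₀ + 1)) ((n₀ : ℝ) ^ 2 + 1),
      le_trans (le_max_left _ _) (le_max_left _ _), le_trans (le_max_right _ _) (le_max_left _ _),
      le_max_right _ _⟩
  have hm1 : 1 ≤ m := by linarith [sq_nonneg (n₀ : ℝ)]
  have hm0 : 0 < m := by linarith
  have hmM : m ≤ m ^ 11 :=
    calc m = m ^ 1 := (pow_one m).symm
      _ ≤ m ^ 11 := pow_le_pow_right₀ hm1 (by norm_num)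
  have hη0 : (0 : ℝ) < 1 / m ^ 2 := by positivity
  have hηη₀ : 1 / m ^ 2 < η₀ := by
    have h1 : 1 / η₀ < m := by linarith
    have h2 : 1 / m < η₀ := (one_div_lt hm0 hη₀).2 h1
    exact (one_div_le_one_div_of_le hm0 (le_self_pow₀ hm1 two_ne_zero)).trans_lt h2
  -- (4) the induction on `n`
  refine ⟨m ^ 11, fun n => ?_⟩
  induction n using Nat.strong_induction_on with
  | _ n ih =>
  intro hn
  have hn0 : (0 : ℝ) < n := by exact_mod_cast hn
  rcases le_or_gt n n₀ with hsmall | hlarge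
  · -- base range: `γ n ≤ 1 ≤ M/n²`
    rw [le_div_iff₀ (by positivity)]
    have hnn₀ : (n : ℝ) ≤ n₀ := by exact_mod_cast hsmall
    have hγ1 := h1 n
    have hγ0 := h0 n
    calc γ n * (n : ℝ) ^ 2 ≤ 1 * (n₀ : ℝ) ^ 2 := by gcongr
      _ = (n₀ : ℝ) ^ 2 := one_mul _
      _ ≤ m ^ 11 := by linarith
  · -- induction step at `n = r(1+λ) > n₀`, i.e. `r > r₀`
    obtain ⟨r, hr_def⟩ : ∃ r : ℝ, r = n / (1 + lam) := ⟨_, rfl⟩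
    have hr0 : 0 < r := by rw [hr_def]; positivity
    have hrn : r * (1 + lam) = n := by rw [hr_def]; field_simp
    have hr₀r : r₀ < r := by
      have h2 : (n₀ : ℝ) < n := by exact_mod_cast hlarge
      rw [hr_def, lt_div_iff₀ (by positivity)]
      linarith
    have hr4 : 4 ≤ r := by linarith
    have hrltn : r < n := by
      rw [← hrn]; exact lt_mul_of_one_lt_right hr0 (by linarith)
    -- the two earlier values of `γ` used: at `k₁ = ⌊r⌋` and `k₂ = ⌊λr/2⌋`
    obtain ⟨k₁, hk₁⟩ : ∃ k : ℕ, k = ⌊r⌋₊ := ⟨_, rfl⟩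
    obtain ⟨k₂, hk₂⟩ : ∃ k : ℕ, k = ⌊lam * r / 2⌋₊ := ⟨_, rfl⟩
    have hk₁r : (k₁ : ℝ) ≤ r := by rw [hk₁]; exact Nat.floor_le hr0.le
    have hk₁n : k₁ < n := by exact_mod_cast hk₁r.trans_lt hrltn
    have hk₁1 : 1 ≤ k₁ := by rw [hk₁]; exact Nat.le_floor (by push_cast; linarith)
    have hρr : ρ * r ≤ k₁ := by
      have h1 : r - 1 < k₁ := by rw [hk₁]; exact Nat.sub_one_lt_floor r
      have h2 : ρ * r = r - r / r₀ := by rw [hρ_def]; ring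
      have h3 : 1 ≤ r / r₀ := by rw [le_div_iff₀ hr₀0]; linarith
      linarith
    have hlamr4 : 1 ≤ lam * r / 4 := by
      have h1 : lam * (4 / lam) = 4 := by field_simp
      have h2 : lam * (4 / lam) ≤ lam * r := mul_le_mul_of_nonneg_left (by linarith) hlam0.le
      linarith
    have hk₂r : lam * r / 4 ≤ k₂ := by
      have h1 : lam * r / 2 - 1 < k₂ := by rw [hk₂]; exact Nat.sub_one_lt_floor _
      linarith
    have hk₂1 : 1 ≤ k₂ := by exact_mod_cast hlamr4.trans hk₂r
    have hk₂n : k₂ < n := by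
      have h1 : (k₂ : ℝ) ≤ lam * r / 2 := by rw [hk₂]; exact Nat.floor_le (by positivity)
      have h2 : lam * r ≤ 1 * r := mul_le_mul_of_nonneg_right hlam1 hr0.le
      have h3 : (k₂ : ℝ) < n := by linarith
      exact_mod_cast h3
    -- induction hypotheses, rounded, and the recursion (2.1) at `η = m⁻²`, `r = n/(1+λ)`
    have hγ₁ : γ k₁ ≤ m ^ 11 / (ρ * r) ^ 2 :=
      le_div_sq_of_le_div_natCast_sq (by positivity) (by positivity) hρr (ih k₁ hk₁n hk₁1)
    have hγ₂ : γ k₂ ≤ m ^ 11 / (lam * r / 4) ^ 2 :=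
      le_div_sq_of_le_div_natCast_sq (by positivity) (by positivity) hk₂r (ih k₂ hk₂n hk₂1)
    have hR := Hη (1 / m ^ 2) hη0 hηη₀ r hr0
    rw [hrn, Nat.floor_natCast, ← hk₁, ← hk₂] at hR
    rw [← hrn]
    exact oneArmRecursion_step hc0 hc2 hcc₁ hC₁ hlam0 hlam_sq hρ0 hρhalf hstep3 hm0 hmA rfl rfl hr0
      (h0 k₁) (h0 k₂) hγ₁ hγ₂ hR

/-- `0 ≤ P_p(0 ↔ ∂Q_n) ≤ 1`. [folklore] -/
theorem oneArmProb_mem_Icc (d : ℕ) (p : unitInterval) (n : ℕ) : oneArmProb d p n ∈ Set.Icc 0 1 :=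
  ⟨measureReal_nonneg, measureReal_le_one⟩

/-- **Kozma–Nachmias 2011, Thm. 1 (upper bound) from Lemma 2.3**: the recursive inequality (2.1)
for `γ(r) = P_{p_c}(0 ↔ ∂Q_r)` (`KozmaNachmias2011_lemma23`) implies the named fact
`KozmaNachmias2011_oneArmUpper` (`P_{p_c}(0 ↔ ∂Q_n) ≤ C/n²`, `n ≥ 1`, for `d > 6` under the
two-point estimate), by the induction of p. 384 (`upper_of_oneArmRecursion`).
[cite: KozmaNachmias2011, §2, Proof of Theorem 1 (p. 384)] -/
theorem KozmaNachmias2011_oneArmUpper_of_lemma23 (h : KozmaNachmias2011_lemma23) :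
    KozmaNachmias2011_oneArmUpper := by
  intro d hd hτ
  obtain ⟨M, hM⟩ := upper_of_oneArmRecursion (fun n => (oneArmProb_mem_Icc d _ n).1)
    (fun n => (oneArmProb_mem_Icc d _ n).2) (h d hd hτ)
  exact ⟨M, hM⟩

/-- Hence `ρ_ex = 1/2` (`RhoExHalf d`, bounded-ratio sense) for `d > 6` under the two-point
estimate, granted Lemma 2.3: the lower bound is proved in `LaceExpansionHighDimensionProofs.lean`
(`TwoPointBoundedRatio.oneArmProb_lower`). [cite: KozmaNachmias2011, Thm. 1 (conditional version, §1.1)] -/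
theorem KozmaNachmias2011_lemma23.rhoExHalf (h : KozmaNachmias2011_lemma23) (hd : 6 < d)
    (hτ : TwoPointBoundedRatio d) : RhoExHalf d :=
  (KozmaNachmias2011_oneArmUpper_of_lemma23 h).rhoExHalf hd hτ

end Induction

end Literature.Barriers.CriticalPhenomena

end
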